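import Summits.Ventures.PercRepro.GenQFlatLatticeL
import Summits.Ventures.PercRepro.GenQFlatLatticeK
import Summits.Ventures.PercRepro.GenQTraceProfileD

/-!
# PercRepro — the empty classes of the integer split at corank `10` (night-4, gen 13)

The two-level profile LP at `q = 7`, type `6`, corank `10` (`n = 17`) is closed CLASS BY CLASS on the integer
split `(h₁₅, h₁₄)` of the top trace counts — `h₁₅ ≤ 1`, `(2, 0)`, `(2, 1)`, `(3, 0)` (the class theorems
`jq_t6_nonneg_c10_q7_m0_two_level_*`).  This file proves that the other classes are EMPTY (sheet §65 (d)).  With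
`h₁₅ ≥ 2` the `15`-traces form a pencil through the rank-`5` flat `F = H₁ ∩ H₂` with `f = |F ∩ G| ≥ 13` points
(`GenQFlatLatticeJ`); a `14`-trace `K` meets `F ∩ G` in at most `10` points
(`card_inter_pencil_le_ten_of_flatsTr_fourteen`: with `≥ 11` points `K ∩ F ∩ G` has rank `5`, so `F ⊆ K`; for
`f = 14` the trace `K ∩ G = F ∩ G` has rank `≤ 5`, for `f = 13` a point of `K ∩ G` outside `F` lies outside both
`15`-traces, `K ∩ Hᵢ = F` being nested rank-`5` flats, and `G` would have `≥ 18` points).  Hence `h₁₅ = 3`, which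
forces `f = 14` (`3 · (15 − f) ≤ 17 − f`), leaves no `14`-trace at all (`hypTr_fourteen_eq_zero_of_three`), and
`h₁₅ = 2` leaves at most one: every `14`-trace is `S ∪ (G ∖ F)` with `S = K ∩ F ∩ G` a `10`-point set of rank
`4`, two of them share `≥ 7` points of `F ∩ G`, hence their closures, hence their traces, hence coincide
(`hypTr_fourteen_le_one_of_two`).  With the pencil cap `h₁₅ ≤ 3` (`hypTr_fifteen_le_three`, from
`pencil_hypTr_mul_le`) this is exactly the case split of the unconditional corank-`10` theorem
(`Night4LT6C10Q7M0Z`).  The bound `flats_le_three_card_le_six` (flats of rank `≤ 3` have `≤ 6` points) is the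
`q = 6` twin of `flats_le_four_card_le_ten`, the bridge the trace-layer certificates need.
Imports `GenQFlatLatticeL`, `GenQFlatLatticeK`, `GenQTraceProfileD`.
-/
namespace PercRepro.Night4

open Finset ThmH SixFour GenQ PerFlat Star

variable {α : Type*} [DecidableEq α] {M : Matroid α} [M.Finite]

/-- The flats of rank `≤ 3` of the core have `≤ 6` points (simple; lines `≤ 3`, planes `≤ 6`) — the `q = 6`
flat-bound bridge. -/
theorem flats_le_three_card_le_six (hs : Simple M) (hline : ∀ L ∈ flatsQ M 2, L.card ≤ 3)
    (hplane : ∀ P ∈ flatsQ M 3, P.card ≤ 6) :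
    ∀ a ≤ 6 - 3, ∀ K ∈ flatsQ M a, K.card ≤ 6 := by
  intro a ha K hK
  rcases Nat.lt_or_ge a 2 with h1 | h2
  · have := card_le_one_of_flatsQ_le_one hs (by omega : a ≤ 1) hK
    omega
  · rcases Nat.lt_or_ge a 3 with h3 | h4
    · have ha2 : a = 2 := by omega
      rw [ha2] at hK
      have := hline _ hK
      omega
    · have ha3 : a = 3 := by omega
      rw [ha3] at hK
      exact hplane _ hK

omit [DecidableEq α] in
/-- Two flats of the same rank, one inside the other, coincide. -/
theorem eq_of_subset_of_mem_flatsQ {a : ℕ} {F F' : Finset α} (hF : F ∈ flatsQ M a) (hF' : F' ∈ flatsQ M a)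
    (hsub : F ⊆ F') : F = F' := by
  have h1 := mem_flatsQ.1 hF
  have h1' := mem_flatsQ.1 hF'
  have hcl : M.closure (F : Set α) = M.closure (F' : Set α) :=
    (M.isRkFinite_of_finite (Finset.finite_toSet F)).closure_eq_closure_of_subset_of_eRk_ge_eRk
      (Finset.coe_subset.2 hsub) (by rw [h1.2.2, h1'.2.2])
  rw [h1.2.1.closure, h1'.2.1.closure] at hcl
  exact Finset.coe_injective hcl

omit [DecidableEq α] in
/-- A subset of a flat with the flat's rank spans it: the flat lies inside every flat containing the subset. -/
theorem subset_of_subset_of_eRk_eq {a : ℕ} {F K A : Finset α} (hF : F ∈ flatsQ M a)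
    (hK : M.IsFlat (K : Set α)) (hAF : A ⊆ F) (hAK : A ⊆ K) (hA : M.eRk (A : Set α) = (a : ℕ∞)) : F ⊆ K := by
  have h1 := mem_flatsQ.1 hF
  have hcl : M.closure (A : Set α) = M.closure (F : Set α) :=
    (M.isRkFinite_of_finite (Finset.finite_toSet A)).closure_eq_closure_of_subset_of_eRk_ge_eRk
      (Finset.coe_subset.2 hAF) (by rw [h1.2.2, hA])
  rw [h1.2.1.closure] at hcl
  rw [← Finset.coe_subset, ← hcl]
  calc M.closure (A : Set α) ⊆ M.closure (K : Set α) := M.closure_subset_closure (Finset.coe_subset.2 hAK)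
    _ = K := hK.closure

/-- The intersection of two members of `flatsQ` is a flat (finset form). -/
theorem isFlat_coe_inter_of_mem_flatsQ {a b : ℕ} {F F' : Finset α} (hF : F ∈ flatsQ M a)
    (hF' : F' ∈ flatsQ M b) : M.IsFlat ((F ∩ F' : Finset α) : Set α) := by
  rw [Finset.coe_inter]
  exact isFlat_inter_of_isFlat' (mem_flatsQ.1 hF).2.1 (mem_flatsQ.1 hF').2.1

/-- Two traces of distinct sizes come from distinct flats. -/
theorem ne_of_mem_flatsTr_of_card_ne {G H K : Finset α} {r s t : ℕ} (hH : H ∈ flatsTr M G r s)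
    (hK : K ∈ flatsTr M G r t) (hst : s ≠ t) : H ≠ K := by
  intro h
  subst h
  exact hst ((mem_flatsTr.1 hH).2.1.symm.trans (mem_flatsTr.1 hK).2.1)

/-- **The `14`-traces meet the pencil's flat in `≤ 10` points** (`n = 17`, `q = 7`): for two distinct
`15`-traces `H₁ ≠ H₂` and a `14`-trace `K`, `|K ∩ (H₁ ∩ H₂) ∩ G| ≤ 10`. -/
theorem card_inter_pencil_le_ten_of_flatsTr_fourteen (hs : Simple M) (hline : ∀ L ∈ flatsQ M 2, L.card ≤ 3)
    (hplane : ∀ P ∈ flatsQ M 3, P.card ≤ 6) (hsolid : ∀ F ∈ flatsQ M 4, F.card ≤ 10) {G : Finset α}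
    (hG : G ⊆ gr M) (hcard : G.card = 17) {H₁ H₂ K : Finset α} (hH₁ : H₁ ∈ flatsTr M G 6 15)
    (hH₂ : H₂ ∈ flatsTr M G 6 15) (hne : H₁ ≠ H₂) (hK : K ∈ flatsTr M G 6 14) :
    ((K ∩ (H₁ ∩ H₂)) ∩ G).card ≤ 10 := by
  have hB := flats_le_four_card_le_ten hs hline hplane hsolid
  have hF : H₁ ∩ H₂ ∈ flatsQ M 5 :=
    inter_mem_flatsQ_of_large_traces (q := 7) (s := 15) (B := 10) (by norm_num) hB hH₁ hH₂ hne (by omega)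
  have hf13 : 13 ≤ ((H₁ ∩ H₂) ∩ G).card := by
    have := two_mul_sub_le_card_inter_of_mem_flatsTr hH₁ hH₂
    omega
  have hH₁' := mem_flatsTr.1 hH₁
  have hH₂' := mem_flatsTr.1 hH₂
  have hK' := mem_flatsTr.1 hK
  have hF' := mem_flatsQ.1 hF
  have hK'' := mem_flatsQ.1 hK'.1
  by_contra hgt
  replace hgt : 10 < ((K ∩ (H₁ ∩ H₂)) ∩ G).card := not_le.1 hgt
  -- `K ∩ F ∩ G` has `≥ 11` points inside `F ∩ G`, hence rank `5`, hence spans `F`: `F ⊆ K`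
  have hA : (K ∩ (H₁ ∩ H₂)) ∩ G ⊆ (H₁ ∩ H₂) ∩ G :=
    Finset.inter_subset_inter Finset.inter_subset_right (Finset.Subset.refl G)
  have hrkA : M.eRk (((K ∩ (H₁ ∩ H₂)) ∩ G : Finset α) : Set α) = ((5 : ℕ) : ℕ∞) :=
    eRk_eq_of_subset_flat_of_flats_le (q := 7) (B := 10) (by norm_num) hB hG hF hA hgt
  have hFK : H₁ ∩ H₂ ⊆ K :=
    subset_of_subset_of_eRk_eq hF hK''.2.1 (hA.trans Finset.inter_subset_left)
      (Finset.inter_subset_left.trans Finset.inter_subset_left) hrkA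
  have hFGK : (H₁ ∩ H₂) ∩ G ⊆ K ∩ G := Finset.inter_subset_inter hFK (Finset.Subset.refl G)
  have hf14 : ((H₁ ∩ H₂) ∩ G).card ≤ 14 := by
    have := Finset.card_le_card hFGK
    omega
  rcases Nat.lt_or_ge ((H₁ ∩ H₂) ∩ G).card 14 with hlt | hge
  · -- `f = 13`: a point `y` of `K ∩ G` outside `F`, which lies outside both `15`-traces
    have hf : ((H₁ ∩ H₂) ∩ G).card = 13 := by omega
    have hpos : 0 < ((K ∩ G) \ ((H₁ ∩ H₂) ∩ G)).card := by
      rw [Finset.card_sdiff_of_subset hFGK]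
      omega
    obtain ⟨y, hy⟩ := Finset.card_pos.1 hpos
    rw [Finset.mem_sdiff, Finset.mem_inter, Finset.mem_inter, Finset.mem_inter] at hy
    -- `K ∩ Hᵢ = F`: nested rank-`5` flats
    have hKH : ∀ H ∈ flatsTr M G 6 15, H₁ ∩ H₂ ⊆ H → K ∩ H = H₁ ∩ H₂ := by
      intro H hH hFH
      have hH' := mem_flatsTr.1 hH
      have hneK : K ≠ H := ne_of_mem_flatsTr_of_card_ne hK hH (by norm_num)
      obtain ⟨a, hKa, ha⟩ := inter_mem_flatsQ_of_ne' (r := 5) hK'.1 hH'.1 hneK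
      have hFKH : H₁ ∩ H₂ ⊆ K ∩ H := Finset.subset_inter hFK hFH
      have ha5 : a = 5 := by
        have h1 := mem_flatsQ.1 hKa
        have hle : ((5 : ℕ) : ℕ∞) ≤ (a : ℕ∞) := by
          rw [← hF'.2.2, ← h1.2.2]
          exact M.eRk_mono (Finset.coe_subset.2 hFKH)
        have : 5 ≤ a := by exact_mod_cast hle
        omega
      rw [ha5] at hKa
      exact (eq_of_subset_of_mem_flatsQ hF hKa hFKH).symm
    have hy1 : y ∉ H₁ := by
      intro hyH
      have hmem : y ∈ K ∩ H₁ := Finset.mem_inter.2 ⟨hy.1.1, hyH⟩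
      rw [hKH H₁ hH₁ Finset.inter_subset_left, Finset.mem_inter] at hmem
      exact hy.2 ⟨hmem, hy.1.2⟩
    have hy2 : y ∉ H₂ := by
      intro hyH
      have hmem : y ∈ K ∩ H₂ := Finset.mem_inter.2 ⟨hy.1.1, hyH⟩
      rw [hKH H₂ hH₂ Finset.inter_subset_right, Finset.mem_inter] at hmem
      exact hy.2 ⟨hmem, hy.1.2⟩
    -- `G ⊇ (H₁ ∩ G) ∪ (H₂ ∩ G) ∪ {y}` has `≥ 15 + 15 − 13 + 1 = 18` points
    have hinter : (H₁ ∩ G) ∩ (H₂ ∩ G) = (H₁ ∩ H₂) ∩ G := by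
      ext x
      simp only [Finset.mem_inter]
      tauto
    have hu : ((H₁ ∩ G) ∪ (H₂ ∩ G)).card = 17 := by
      have h1 := Finset.card_union_add_card_inter (H₁ ∩ G) (H₂ ∩ G)
      rw [hinter, hf, hH₁'.2.1, hH₂'.2.1] at h1
      omega
    have hy3 : y ∉ (H₁ ∩ G) ∪ (H₂ ∩ G) := by
      simp only [Finset.mem_union, Finset.mem_inter, not_or]
      exact ⟨fun h => hy1 h.1, fun h => hy2 h.1⟩
    have hsub : insert y ((H₁ ∩ G) ∪ (H₂ ∩ G)) ⊆ G := by
      intro x hx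
      rw [Finset.mem_insert, Finset.mem_union, Finset.mem_inter, Finset.mem_inter] at hx
      rcases hx with rfl | hx | hx
      · exact hy.1.2
      · exact hx.2
      · exact hx.2
    have := Finset.card_le_card hsub
    rw [Finset.card_insert_of_notMem hy3, hu] at this
    omega
  · -- `f = 14`: `K ∩ G = F ∩ G` has rank `≤ 5`
    have heq : (H₁ ∩ H₂) ∩ G = K ∩ G := Finset.eq_of_subset_of_card_le hFGK (by omega)
    have h1 : M.eRk ((K ∩ G : Finset α) : Set α) ≤ M.eRk ((H₁ ∩ H₂ : Finset α) : Set α) := by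
      rw [← heq]
      exact M.eRk_mono (Finset.coe_subset.2 Finset.inter_subset_left)
    rw [hK'.2.2, hF'.2.2] at h1
    have : (6 : ℕ) ≤ 5 := by exact_mod_cast h1
    omega

/-- The pencil cap at `n = 17`, `q = 7`: `h₁₅ ≤ 3` (`3 · 15 − 2 · 17 = 11 > 10`, `f* = 14`,
`h₁₅ · 1 ≤ 17 − 14`). -/
theorem hypTr_fifteen_le_three (hs : Simple M) (hline : ∀ L ∈ flatsQ M 2, L.card ≤ 3)
    (hplane : ∀ P ∈ flatsQ M 3, P.card ≤ 6) (hsolid : ∀ F ∈ flatsQ M 4, F.card ≤ 10)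
    (hflat5 : ∀ F ∈ flatsQ M 5, F.card ≤ 21) {G : Finset α} (hcard : G.card = 17) :
    hypTr M G 6 15 ≤ 3 := by
  have hB := flats_le_four_card_le_ten hs hline hplane hsolid
  rcases Nat.lt_or_ge (hypTr M G 6 15) 2 with h | h
  · omega
  · have hpm := pencil_hypTr_mul_le (G := G) (q := 7) (s := 15) (B := 10) (B₂ := 21) (by norm_num) hB hflat5 (by omega) h
    have h14 : min 21 (15 - 1) = 14 := by norm_num
    change hypTr M G 6 15 * (15 - min 21 (15 - 1)) ≤ G.card - min 21 (15 - 1) at hpm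
    rw [h14] at hpm
    omega

/-- **The class `(3, ≥ 1)` is empty**: at `n = 17`, `q = 7`, `h₁₅ = 3` forces `h₁₄ = 0` (the pencil's flat has
`14` points of `G`, so a `14`-trace would meet it in `≥ 11`). -/
theorem hypTr_fourteen_eq_zero_of_three (hs : Simple M) (hline : ∀ L ∈ flatsQ M 2, L.card ≤ 3)
    (hplane : ∀ P ∈ flatsQ M 3, P.card ≤ 6) (hsolid : ∀ F ∈ flatsQ M 4, F.card ≤ 10) {G : Finset α}
    (hG : G ⊆ gr M) (hcard : G.card = 17) (h3 : hypTr M G 6 15 = 3) : hypTr M G 6 14 = 0 := by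
  have hB := flats_le_four_card_le_ten hs hline hplane hsolid
  obtain ⟨F, hF, hFsub, hpen⟩ :=
    pencil_card_le (G := G) (q := 7) (s := 15) (B := 10) (by norm_num) hB (by omega)
      (by change 2 ≤ hypTr M G 6 15; omega)
  have hpen' : 3 * (15 - (F ∩ G).card) ≤ G.card - (F ∩ G).card := by
    rw [← h3]; exact hpen
  -- two distinct `15`-traces; the pencil's flat is their intersection
  have h2 : 1 < (flatsTr M G 6 15).card := by unfold hypTr at h3; omega
  obtain ⟨H₁, hH₁, H₂, hH₂, hne⟩ := Finset.one_lt_card.1 h2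
  have hF12 : H₁ ∩ H₂ ∈ flatsQ M 5 :=
    inter_mem_flatsQ_of_large_traces (q := 7) (s := 15) (B := 10) (by norm_num) hB hH₁ hH₂ hne (by omega)
  have hFeq : F = H₁ ∩ H₂ :=
    eq_of_subset_of_mem_flatsQ hF hF12 (Finset.subset_inter (hFsub H₁ hH₁) (hFsub H₂ hH₂))
  -- `f ≥ 14` from `3 · (15 − f) ≤ 17 − f` and `f < 15`
  have hflt : (F ∩ G).card < 15 := card_inter_lt_of_subset_of_mem_flatsTr (q := 7) (by norm_num) hF hH₁ (hFsub H₁ hH₁)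
  have hf14 : 14 ≤ (F ∩ G).card := by omega
  -- no `14`-trace
  unfold hypTr
  rw [Finset.card_eq_zero, Finset.eq_empty_iff_forall_notMem]
  intro K hK
  have hK' := mem_flatsTr.1 hK
  have hle := card_inter_pencil_le_ten_of_flatsTr_fourteen hs hline hplane hsolid hG hcard hH₁ hH₂ hne hK
  rw [← hFeq] at hle
  -- `|K ∩ F ∩ G| ≥ 14 + 14 − 17 = 11`
  have hinter : (K ∩ G) ∩ (F ∩ G) = (K ∩ F) ∩ G := by
    ext x
    simp only [Finset.mem_inter]
    tauto
  have hsub : (K ∩ G) ∪ (F ∩ G) ⊆ G := Finset.union_subset Finset.inter_subset_right Finset.inter_subset_right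
  have h1 := Finset.card_union_add_card_inter (K ∩ G) (F ∩ G)
  have h2 := Finset.card_le_card hsub
  rw [hinter, hK'.2.1] at h1
  omega

/-- **The class `(2, ≥ 2)` is empty**: at `n = 17`, `q = 7`, `h₁₅ = 2` forces `h₁₄ ≤ 1` (every `14`-trace is
`S ∪ (G ∖ F)` with `S = K ∩ F ∩ G` a `10`-point set of rank `≤ 4` in the flat `K ∩ F`; two of them share `≥ 7`
points of `F ∩ G`, hence their closures, hence their traces, hence coincide). -/
theorem hypTr_fourteen_le_one_of_two (hs : Simple M) (hline : ∀ L ∈ flatsQ M 2, L.card ≤ 3)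
    (hplane : ∀ P ∈ flatsQ M 3, P.card ≤ 6) (hsolid : ∀ F ∈ flatsQ M 4, F.card ≤ 10) {G : Finset α}
    (hG : G ⊆ gr M) (hcard : G.card = 17) (h2 : hypTr M G 6 15 = 2) : hypTr M G 6 14 ≤ 1 := by
  have hB := flats_le_four_card_le_ten hs hline hplane hsolid
  have hB6 := flats_le_three_card_le_six hs hline hplane
  have h2' : 1 < (flatsTr M G 6 15).card := by unfold hypTr at h2; omega
  obtain ⟨H₁, hH₁, H₂, hH₂, hne⟩ := Finset.one_lt_card.1 h2'
  have hF : H₁ ∩ H₂ ∈ flatsQ M 5 :=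
    inter_mem_flatsQ_of_large_traces (q := 7) (s := 15) (B := 10) (by norm_num) hB hH₁ hH₂ hne (by omega)
  have hF' := mem_flatsQ.1 hF
  have hf13 : 13 ≤ ((H₁ ∩ H₂) ∩ G).card := by
    have := two_mul_sub_le_card_inter_of_mem_flatsTr hH₁ hH₂
    omega
  have hGE : (G : Set α) ⊆ M.E := by
    rw [← coe_gr M]
    exact Finset.coe_subset.2 hG
  -- the structure of a `14`-trace: `S = K ∩ F ∩ G` has exactly `10` points and rank `≤ 4`, `f = 13`, and
  -- `(K ∩ G) ∖ F = G ∖ F`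
  have hstruct : ∀ K ∈ flatsTr M G 6 14,
      ((K ∩ (H₁ ∩ H₂)) ∩ G).card = 10 ∧ ((H₁ ∩ H₂) ∩ G).card = 13 ∧
      (∃ a : ℕ, a ≤ 4 ∧ M.eRk (((K ∩ (H₁ ∩ H₂)) ∩ G : Finset α) : Set α) = (a : ℕ∞)) ∧
      (K ∩ G) \ ((H₁ ∩ H₂) ∩ G) = G \ ((H₁ ∩ H₂) ∩ G) := by
    intro K hK
    have hK' := mem_flatsTr.1 hK
    have hK'' := mem_flatsQ.1 hK'.1
    have hle := card_inter_pencil_le_ten_of_flatsTr_fourteen hs hline hplane hsolid hG hcard hH₁ hH₂ hne hK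
    have hinter : (K ∩ G) ∩ ((H₁ ∩ H₂) ∩ G) = (K ∩ (H₁ ∩ H₂)) ∩ G := by
      ext x
      simp only [Finset.mem_inter]
      tauto
    have hsub : (K ∩ G) ∪ ((H₁ ∩ H₂) ∩ G) ⊆ G :=
      Finset.union_subset Finset.inter_subset_right Finset.inter_subset_right
    have h1 := Finset.card_union_add_card_inter (K ∩ G) ((H₁ ∩ H₂) ∩ G)
    have h2 := Finset.card_le_card hsub
    rw [hinter, hK'.2.1] at h1
    have hS10 : ((K ∩ (H₁ ∩ H₂)) ∩ G).card = 10 := by omega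
    have hf : ((H₁ ∩ H₂) ∩ G).card = 13 := by omega
    refine ⟨hS10, hf, ?_, ?_⟩
    · -- rank `≤ 4`: with rank `5` the set would span `F`, and `F ∩ G ⊆ K ∩ F ∩ G` would have `13 ≤ 10` points
      obtain ⟨a, ha⟩ := exists_eRk_eq_nat' (M := M) ((K ∩ (H₁ ∩ H₂)) ∩ G)
      refine ⟨a, ?_, ha⟩
      by_contra hgt
      replace hgt : 4 < a := not_le.1 hgt
      have hale : a ≤ 5 := by
        have hle' : (a : ℕ∞) ≤ ((5 : ℕ) : ℕ∞) := by
          rw [← ha, ← hF'.2.2]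
          exact M.eRk_mono (Finset.coe_subset.2 (Finset.inter_subset_left.trans Finset.inter_subset_right))
        exact_mod_cast hle'
      have ha5 : a = 5 := by omega
      rw [ha5] at ha
      have hFK : H₁ ∩ H₂ ⊆ K :=
        subset_of_subset_of_eRk_eq hF hK''.2.1 (Finset.inter_subset_left.trans Finset.inter_subset_right)
          (Finset.inter_subset_left.trans Finset.inter_subset_left) ha
      have hFGS : (H₁ ∩ H₂) ∩ G ⊆ (K ∩ (H₁ ∩ H₂)) ∩ G := by
        intro x hx
        rw [Finset.mem_inter] at hx ⊢
        exact ⟨Finset.mem_inter.2 ⟨hFK hx.1, hx.1⟩, hx.2⟩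
      have := Finset.card_le_card hFGS
      omega
    · -- `(K ∩ G) ∖ (F ∩ G)` has `4` points inside `G ∖ (F ∩ G)`, which has `4`
      refine Finset.eq_of_subset_of_card_le ?_ ?_
      · intro x hx
        rw [Finset.mem_sdiff] at hx
        rw [Finset.mem_sdiff]
        exact ⟨(Finset.mem_inter.1 hx.1).2, hx.2⟩
      · have e1 : ((K ∩ G) \ ((H₁ ∩ H₂) ∩ G)).card = 14 - 10 := by
          rw [Finset.card_sdiff, Finset.inter_comm ((H₁ ∩ H₂) ∩ G) (K ∩ G), hinter, hK'.2.1, hS10]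
        have e2 : (G \ ((H₁ ∩ H₂) ∩ G)).card = 17 - 13 := by
          rw [Finset.card_sdiff, Finset.inter_eq_left.2 Finset.inter_subset_right, hcard, hf]
        omega
  -- at most one `14`-trace
  unfold hypTr
  rw [Finset.card_le_one]
  intro K hK K' hK'
  by_contra hneK
  obtain ⟨hS, hf, ⟨a, ha4, ha⟩, hout⟩ := hstruct K hK
  obtain ⟨hS', -, ⟨a', ha4', ha'⟩, hout'⟩ := hstruct K' hK'
  have hKm := mem_flatsTr.1 hK
  have hKm' := mem_flatsTr.1 hK'
  -- the two `10`-sets share `≥ 7` points of `F ∩ G`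
  have hSF : (K ∩ (H₁ ∩ H₂)) ∩ G ⊆ (H₁ ∩ H₂) ∩ G :=
    Finset.inter_subset_inter Finset.inter_subset_right (Finset.Subset.refl G)
  have hSF' : (K' ∩ (H₁ ∩ H₂)) ∩ G ⊆ (H₁ ∩ H₂) ∩ G :=
    Finset.inter_subset_inter Finset.inter_subset_right (Finset.Subset.refl G)
  have h7 : 7 ≤ (((K ∩ (H₁ ∩ H₂)) ∩ G) ∩ ((K' ∩ (H₁ ∩ H₂)) ∩ G)).card := by
    have h1 := Finset.card_union_add_card_inter ((K ∩ (H₁ ∩ H₂)) ∩ G) ((K' ∩ (H₁ ∩ H₂)) ∩ G)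
    have h2 := Finset.card_le_card (Finset.union_subset hSF hSF')
    omega
  -- hence rank `≥ 4`, so the common part spans `S` and `S'`
  have hr4 : ((6 - 2 : ℕ) : ℕ∞) ≤
      M.eRk ((((K ∩ (H₁ ∩ H₂)) ∩ G) ∩ ((K' ∩ (H₁ ∩ H₂)) ∩ G) : Finset α) : Set α) :=
    le_eRk_of_flats_le (q := 6) (B := 6) (by norm_num) hB6 hG
      (Finset.inter_subset_left.trans Finset.inter_subset_right) (by omega)
  have hcl : ∀ (L : Finset α), L ∈ flatsTr M G 6 14 →
      M.closure ((((K ∩ (H₁ ∩ H₂)) ∩ G) ∩ ((K' ∩ (H₁ ∩ H₂)) ∩ G) : Finset α) : Set α)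
        = M.closure (((L ∩ (H₁ ∩ H₂)) ∩ G : Finset α) : Set α) →
      M.closure ((((K ∩ (H₁ ∩ H₂)) ∩ G) ∩ ((K' ∩ (H₁ ∩ H₂)) ∩ G) : Finset α) : Set α)
        ⊆ ((L ∩ (H₁ ∩ H₂) : Finset α) : Set α) := by
    intro L hL hLc
    rw [hLc]
    have hLm := mem_flatsTr.1 hL
    have hflat : M.IsFlat ((L ∩ (H₁ ∩ H₂) : Finset α) : Set α) := isFlat_coe_inter_of_mem_flatsQ hLm.1 hF
    calc M.closure (((L ∩ (H₁ ∩ H₂)) ∩ G : Finset α) : Set α)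
        ⊆ M.closure ((L ∩ (H₁ ∩ H₂) : Finset α) : Set α) :=
          M.closure_subset_closure (Finset.coe_subset.2 Finset.inter_subset_left)
      _ = ((L ∩ (H₁ ∩ H₂) : Finset α) : Set α) := hflat.closure
  have hclS : M.closure ((((K ∩ (H₁ ∩ H₂)) ∩ G) ∩ ((K' ∩ (H₁ ∩ H₂)) ∩ G) : Finset α) : Set α)
      = M.closure (((K ∩ (H₁ ∩ H₂)) ∩ G : Finset α) : Set α) :=
    (M.isRkFinite_of_finite (Finset.finite_toSet _)).closure_eq_closure_of_subset_of_eRk_ge_eRk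
      (Finset.coe_subset.2 Finset.inter_subset_left) (by
        rw [ha]
        refine le_trans ?_ hr4
        exact_mod_cast ha4)
  have hclS' : M.closure ((((K ∩ (H₁ ∩ H₂)) ∩ G) ∩ ((K' ∩ (H₁ ∩ H₂)) ∩ G) : Finset α) : Set α)
      = M.closure (((K' ∩ (H₁ ∩ H₂)) ∩ G : Finset α) : Set α) :=
    (M.isRkFinite_of_finite (Finset.finite_toSet _)).closure_eq_closure_of_subset_of_eRk_ge_eRk
      (Finset.coe_subset.2 Finset.inter_subset_right) (by
        rw [ha']
        refine le_trans ?_ hr4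
        exact_mod_cast ha4')
  -- `S ⊆ cl S = cl (S ∩ S') ⊆ K' ∩ F`, so `S ⊆ S'`, and they have the same size
  have hSS' : (K ∩ (H₁ ∩ H₂)) ∩ G ⊆ (K' ∩ (H₁ ∩ H₂)) ∩ G := by
    intro x hx
    have hx1 : x ∈ M.closure (((K ∩ (H₁ ∩ H₂)) ∩ G : Finset α) : Set α) :=
      M.subset_closure _ ((Finset.coe_subset.2 Finset.inter_subset_right).trans hGE) (Finset.mem_coe.2 hx)
    rw [← hclS] at hx1
    have hx2 := hcl K' hK' hclS' hx1
    rw [Finset.mem_coe] at hx2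
    exact Finset.mem_inter.2 ⟨hx2, (Finset.mem_inter.1 hx).2⟩
  have hSeq : (K ∩ (H₁ ∩ H₂)) ∩ G = (K' ∩ (H₁ ∩ H₂)) ∩ G :=
    Finset.eq_of_subset_of_card_le hSS' (by omega)
  -- the traces coincide: inside `F` by `hSeq`, outside `F` both are `G ∖ F`
  have htr : K ∩ G ⊆ K' ∩ G := by
    intro x hx
    by_cases hxF : x ∈ H₁ ∩ H₂
    · have hxS : x ∈ (K ∩ (H₁ ∩ H₂)) ∩ G :=
        Finset.mem_inter.2 ⟨Finset.mem_inter.2 ⟨(Finset.mem_inter.1 hx).1, hxF⟩, (Finset.mem_inter.1 hx).2⟩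
      rw [hSeq] at hxS
      exact Finset.mem_inter.2 ⟨(Finset.mem_inter.1 (Finset.mem_inter.1 hxS).1).1, (Finset.mem_inter.1 hxS).2⟩
    · have hxo : x ∈ (K ∩ G) \ ((H₁ ∩ H₂) ∩ G) :=
        Finset.mem_sdiff.2 ⟨hx, fun h => hxF (Finset.mem_inter.1 h).1⟩
      rw [hout, ← hout'] at hxo
      exact (Finset.mem_sdiff.1 hxo).1
  have htreq : K ∩ G = K' ∩ G := Finset.eq_of_subset_of_card_le htr (by rw [hKm.2.1, hKm'.2.1])
  have hKc : (K : Set α) = M.closure ((K ∩ G : Finset α) : Set α) :=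
    coe_eq_closure_inter_of_spanning hKm.1 hKm.2.2
  have hKc' : (K' : Set α) = M.closure ((K' ∩ G : Finset α) : Set α) :=
    coe_eq_closure_inter_of_spanning hKm'.1 hKm'.2.2
  apply hneK
  apply Finset.coe_injective
  rw [hKc, hKc', htreq]

end PercRepro.Night4
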